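import Summits.QuantumFields.YangMills.Theorems.LuscherReductionTwistedTraceScalingFPWeightExplicit
import Summits.QuantumFields.YangMills.Theorems.LuscherReductionTwistedTraceScalingFPWeightDetConstant
import HarnessLib

/-!
# (N2)+(N3) in RELATIVE form: the Faddeev–Popov weight at a slice point is `N̄(s)·(1 ± E)` with `N̄(s) = (2π²)^{-n}(πs²)^{d/2}/√gramDet(0)` and an explicit error
# (lane A of S-BASE, crux `TwistedTraceScaling` stmt-QuantumFields-20203, C4 INNER; design note `pub/ym-fleet/ym-luscher-20007-p1/COARSE-DESIGN.md` §23.12, owe (P))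

`fpWeight_explicit_bounds` (p638588) sandwiches the Faddeev–Popov weight `N(U*)` at a slice tube point `U* = tubePt p` between two explicit Gaussian expressions with the
Gram determinant `gramDet p`; `exists_gramDet_ratio_bound` (p637998) gives `gramDet p = gramDet 0·(1 + O(‖p‖²))`.  THIS FILE divides out the β-dependent constant:
* `fpWeightBar L s = (2π²)^{-n}(πs²)^{d/2}/√(gramDet 0)` (`n = |NzSite L|`, `d = 3n` the dimension of the flat based coordinates) — the would-be constant value of `N` on the core;
* elementary real lemmas: `(X/(1+η))^e ≥ X^e(1 − eη)`, `(X/(1−η))^e ≤ X^e(1 + 4eη)` (`η ≤ 1/2`, `eη ≤ 1/4`), `1/√G` against `1/√G₀` when `|G/G₀ − 1| ≤ x ≤ 1/2`;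
* ★★★ `fpWeight_relative_bounds`: under the hypotheses of `fpWeight_explicit_bounds` plus `η ≤ 1/2`, `(d/2)η ≤ 1/4`, `2^{d/2}e^{−c²r²/(2s²)} ≤ 1/4`, `|gramDet p/gramDet 0 − 1| ≤ x ≤ 1/2`:
  `N̄(s)·(1 − 6nR₁²)·(1 − (d/2)η − 2^{d/2}e^{−c²r²/(2s²)})·(1 − x) ≤ N(U*) ≤ N̄(s)·(1 + 4(d/2)η + 4^{d/2}e^{−c²r²/(4s²)})·(1 + x)`.
The eventually-in-β packaging under the record scaling (`s = β^{-1}`, core `β^{-σ}`, `r = β^{-2σ}`) is the next file.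
HONEST FRAMING: bookkeeping for a stub of a child of the CONDITIONAL reduction route R2b1; no spectral claim; C4 OPEN; not a gap, not Clay.
-/

set_option autoImplicit false

noncomputable section

open MeasureTheory Filter Topology Real Module
open scoped BigOperators
open Literature.MathematicalPhysics.QuantumFieldTheory
open Literature.MathematicalPhysics.QuantumLattice

namespace Summit.QuantumFields.YangMills.Theorems.FemtoTransferGap.TwoLattice.ConstTube

open Summit.QuantumFields.YangMills.Theorems.FemtoTransferGap
open Summit.QuantumFields.YangMills.Theorems.FemtoTransferGap.TwoLattice.Avg
open Summit.QuantumFields.YangMills.Theorems.FemtoTransferGap.TwoLattice.Stiff (LinkSpace)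

/-! ## §1 Elementary real lemmas -/

/-- `(X/(1+η))^e ≥ X^e·(1 − eη)` for `X, η, e ≥ 0`. [folklore] -/
theorem rpow_div_one_add_ge {X η e : ℝ} (hX : 0 ≤ X) (hη : 0 ≤ η) (he : 0 ≤ e) : X ^ e * (1 - e * η) ≤ (X / (1 + η)) ^ e := by
  have h1 : 0 < 1 + η := by linarith
  rw [Real.div_rpow hX h1.le]
  have h2 : (1 + η) ^ e ≤ Real.exp (η * e) := by
    rw [Real.exp_mul]
    exact Real.rpow_le_rpow h1.le (by linarith [Real.add_one_le_exp η]) he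
  have h3 : 0 < (1 + η) ^ e := Real.rpow_pos_of_pos h1 e
  have h4 : 1 - e * η ≤ Real.exp (-(η * e)) := by
    have := Real.add_one_le_exp (-(η * e)); nlinarith
  have h5 : Real.exp (-(η * e)) ≤ ((1 + η) ^ e)⁻¹ := by
    rw [Real.exp_neg]
    exact inv_anti₀ h3 h2
  rw [div_eq_mul_inv]
  exact mul_le_mul_of_nonneg_left (h4.trans h5) (Real.rpow_nonneg hX e)

/-- `(X/(1−η))^e ≤ X^e·(1 + 4eη)` for `X, e ≥ 0`, `0 ≤ η ≤ 1/2`, `eη ≤ 1/4`. [folklore] -/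
theorem rpow_div_one_sub_le {X η e : ℝ} (hX : 0 ≤ X) (hη : 0 ≤ η) (hη2 : η ≤ 1 / 2) (he : 0 ≤ e) (heη : e * η ≤ 1 / 4) :
    (X / (1 - η)) ^ e ≤ X ^ e * (1 + 4 * e * η) := by
  have h1 : 0 < 1 - η := by linarith
  have h2 : X / (1 - η) ≤ X * (1 + 2 * η) := by
    rw [div_le_iff₀ h1]
    have h' : 0 ≤ X * η * (1 - 2 * η) := mul_nonneg (mul_nonneg hX hη) (by linarith)
    nlinarith [h']
  have h3 : (X / (1 - η)) ^ e ≤ (X * (1 + 2 * η)) ^ e := Real.rpow_le_rpow (div_nonneg hX h1.le) h2 he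
  rw [Real.mul_rpow hX (by linarith)] at h3
  refine h3.trans (mul_le_mul_of_nonneg_left ?_ (Real.rpow_nonneg hX e))
  have h4 : (1 + 2 * η) ^ e ≤ Real.exp (2 * η * e) := by
    rw [Real.exp_mul]
    exact Real.rpow_le_rpow (by linarith) (by linarith [Real.add_one_le_exp (2 * η)]) he
  have h5 : Real.exp (2 * η * e) ≤ 1 + 4 * e * η := by
    have h0 : 0 ≤ 2 * η * e := mul_nonneg (mul_nonneg zero_le_two hη) he
    have hx : |2 * η * e| ≤ 1 := by rw [abs_of_nonneg h0]; nlinarith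
    have h6 := Real.abs_exp_sub_one_le hx
    have h7 := (abs_le.mp h6).2
    rw [abs_of_nonneg h0] at h7
    nlinarith
  exact h4.trans h5

/-- `(X/a)^e = a^{-e}... ` in the form used for the tails: `(X/(1/m))^e = m^e · X^e` (`X ≥ 0`, `m > 0`). [folklore] -/
theorem rpow_div_inv_eq {X m e : ℝ} (hX : 0 ≤ X) (hm : 0 < m) : (X / (1 / m)) ^ e = m ^ e * X ^ e := by
  rw [div_div_eq_mul_div, div_one, Real.mul_rpow hX hm.le, mul_comm]

/-- If `|G/G₀ − 1| ≤ x ≤ 1/2` and `G₀ > 0` then `(1 − x)/√G₀ ≤ 1/√G`. [folklore] -/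
theorem inv_sqrt_ge_of_ratio {G G₀ x : ℝ} (hG₀ : 0 < G₀) (hx : |G / G₀ - 1| ≤ x) (hx2 : x ≤ 1 / 2) :
    (1 - x) / Real.sqrt G₀ ≤ 1 / Real.sqrt G := by
  have hx0 : 0 ≤ x := (abs_nonneg _).trans hx
  have hup : G ≤ G₀ * (1 + x) := by
    have := (abs_le.mp hx).2
    rw [div_sub_one hG₀.ne', div_le_iff₀ hG₀] at this; linarith
  have hlo : G₀ * (1 - x) ≤ G := by
    have := (abs_le.mp hx).1
    rw [div_sub_one hG₀.ne', le_div_iff₀ hG₀] at this; linarith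
  have hGpos : 0 < G := lt_of_lt_of_le (by nlinarith) hlo
  have hs₀ := Real.sqrt_pos.mpr hG₀
  have hs := Real.sqrt_pos.mpr hGpos
  rw [div_le_div_iff₀ hs₀ hs, one_mul]
  -- `(1 − x)·√G ≤ √G₀`: square both sides
  have h1 : (1 - x) * Real.sqrt G ≤ Real.sqrt (G₀ * (1 + x)) * (1 - x) := by
    rw [mul_comm]; exact mul_le_mul_of_nonneg_right (Real.sqrt_le_sqrt hup) (by linarith)
  refine h1.trans ?_
  have h2 : Real.sqrt (G₀ * (1 + x)) * (1 - x) = Real.sqrt (G₀ * (1 + x) * (1 - x) ^ 2) := by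
    rw [Real.sqrt_mul' _ (sq_nonneg (1 - x)), Real.sqrt_sq (by linarith)]
  rw [h2]
  refine Real.sqrt_le_sqrt ?_
  have h3 : (1 + x) * (1 - x) ^ 2 ≤ 1 := by nlinarith [sq_nonneg x, mul_nonneg hx0 (sq_nonneg x)]
  have h4 : G₀ * ((1 + x) * (1 - x) ^ 2) ≤ G₀ * 1 := mul_le_mul_of_nonneg_left h3 hG₀.le
  linarith [show G₀ * (1 + x) * (1 - x) ^ 2 = G₀ * ((1 + x) * (1 - x) ^ 2) by ring]

/-- If `|G/G₀ − 1| ≤ x ≤ 1/2` and `G₀ > 0` then `1/√G ≤ (1 + x)/√G₀`. [folklore] -/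
theorem inv_sqrt_le_of_ratio {G G₀ x : ℝ} (hG₀ : 0 < G₀) (hx : |G / G₀ - 1| ≤ x) (hx2 : x ≤ 1 / 2) :
    1 / Real.sqrt G ≤ (1 + x) / Real.sqrt G₀ := by
  have hx0 : 0 ≤ x := (abs_nonneg _).trans hx
  have hlo : G₀ * (1 - x) ≤ G := by
    have := (abs_le.mp hx).1
    rw [div_sub_one hG₀.ne', le_div_iff₀ hG₀] at this; linarith
  have hGpos : 0 < G := lt_of_lt_of_le (by nlinarith) hlo
  have hs₀ := Real.sqrt_pos.mpr hG₀
  have hs := Real.sqrt_pos.mpr hGpos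
  rw [div_le_div_iff₀ hs hs₀, one_mul]
  -- `√G₀ ≤ (1 + x)·√G`; `√G ≥ √(G₀(1−x))` and `(1+x)²(1−x) ≥ 1` for `x ≤ 1/2`
  have h1 : (1 + x) * Real.sqrt (G₀ * (1 - x)) ≤ (1 + x) * Real.sqrt G := mul_le_mul_of_nonneg_left (Real.sqrt_le_sqrt hlo) (by linarith)
  refine le_trans ?_ h1
  have h2 : (1 + x) * Real.sqrt (G₀ * (1 - x)) = Real.sqrt ((1 + x) ^ 2 * (G₀ * (1 - x))) := by
    rw [Real.sqrt_mul (sq_nonneg (1 + x)), Real.sqrt_sq (by linarith)]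
  rw [h2]
  refine Real.sqrt_le_sqrt ?_
  have h3 : 1 ≤ (1 + x) ^ 2 * (1 - x) := by
    have : 0 ≤ x * (1 - x - x ^ 2) := mul_nonneg hx0 (by nlinarith)
    nlinarith
  have h4 : G₀ * 1 ≤ G₀ * ((1 + x) ^ 2 * (1 - x)) := mul_le_mul_of_nonneg_left h3 hG₀.le
  linarith [show (1 + x) ^ 2 * (G₀ * (1 - x)) = G₀ * ((1 + x) ^ 2 * (1 - x)) by ring]

/-- The algebra of the LOWER bound with all transcendental quantities as atoms. [folklore] -/
theorem fpWeight_lower_algebra {A Rsq X e η t G G₀ x N : ℝ} (hA : 0 < A) (hX : 0 ≤ X) (he : 0 ≤ e) (hη : 0 ≤ η) (heη : e * η ≤ 1 / 4)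
    (ht : (2 : ℝ) ^ e * t ≤ 1 / 4) (hR : Rsq ≤ 1) (hG₀ : 0 < G₀) (hx : |G / G₀ - 1| ≤ x) (hx2 : x ≤ 1 / 2)
    (hlo : A * Real.exp (-Rsq) * ((X / (1 + η)) ^ e / Real.sqrt G - t * ((X / (1 / 2)) ^ e / Real.sqrt G)) ≤ N) :
    A * X ^ e / Real.sqrt G₀ * ((1 - Rsq) * ((1 - e * η - (2 : ℝ) ^ e * t) * (1 - x))) ≤ N := by
  have hx0 : 0 ≤ x := (abs_nonneg _).trans hx
  have hXe0 : 0 ≤ X ^ e := Real.rpow_nonneg hX e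
  have hsG₀ : 0 < Real.sqrt G₀ := Real.sqrt_pos.mpr hG₀
  have hsq_lo := inv_sqrt_ge_of_ratio hG₀ hx hx2
  have h1 : X ^ e * (1 - e * η) ≤ (X / (1 + η)) ^ e := rpow_div_one_add_ge hX hη he
  have h2 : (X / (1 / 2)) ^ e = (2 : ℝ) ^ e * X ^ e := rpow_div_inv_eq hX (by norm_num)
  have hbr : X ^ e * (1 - e * η - (2 : ℝ) ^ e * t) ≤ (X / (1 + η)) ^ e - t * (X / (1 / 2)) ^ e := by rw [h2]; nlinarith
  have hbr0 : 0 ≤ 1 - e * η - (2 : ℝ) ^ e * t := by linarith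
  have hexp : 1 - Rsq ≤ Real.exp (-Rsq) := by have := Real.add_one_le_exp (-Rsq); linarith
  have hlo' : A * Real.exp (-Rsq) * (((X / (1 + η)) ^ e - t * (X / (1 / 2)) ^ e) * (1 / Real.sqrt G)) ≤ N := by
    have : A * Real.exp (-Rsq) * ((X / (1 + η)) ^ e / Real.sqrt G - t * ((X / (1 / 2)) ^ e / Real.sqrt G)) =
        A * Real.exp (-Rsq) * (((X / (1 + η)) ^ e - t * (X / (1 / 2)) ^ e) * (1 / Real.sqrt G)) := by ring
    rw [← this]; exact hlo
  have i1 : (X ^ e * (1 - e * η - (2 : ℝ) ^ e * t)) * ((1 - x) / Real.sqrt G₀) ≤ ((X / (1 + η)) ^ e - t * (X / (1 / 2)) ^ e) * (1 / Real.sqrt G) :=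
    mul_le_mul hbr hsq_lo (div_nonneg (by linarith) hsG₀.le) (le_trans (mul_nonneg hXe0 hbr0) hbr)
  have i0 : 0 ≤ ((X / (1 + η)) ^ e - t * (X / (1 / 2)) ^ e) * (1 / Real.sqrt G) :=
    le_trans (mul_nonneg (mul_nonneg hXe0 hbr0) (div_nonneg (by linarith) hsG₀.le)) i1
  calc A * X ^ e / Real.sqrt G₀ * ((1 - Rsq) * ((1 - e * η - (2 : ℝ) ^ e * t) * (1 - x)))
      = A * (1 - Rsq) * ((X ^ e * (1 - e * η - (2 : ℝ) ^ e * t)) * ((1 - x) / Real.sqrt G₀)) := by ring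
    _ ≤ A * (1 - Rsq) * (((X / (1 + η)) ^ e - t * (X / (1 / 2)) ^ e) * (1 / Real.sqrt G)) :=
        mul_le_mul_of_nonneg_left i1 (mul_nonneg hA.le (by linarith))
    _ ≤ A * Real.exp (-Rsq) * (((X / (1 + η)) ^ e - t * (X / (1 / 2)) ^ e) * (1 / Real.sqrt G)) :=
        mul_le_mul_of_nonneg_right (mul_le_mul_of_nonneg_left hexp hA.le) i0
    _ ≤ N := hlo'

/-- The algebra of the UPPER bound with all transcendental quantities as atoms. [folklore] -/
theorem fpWeight_upper_algebra {A X e η t G G₀ x N : ℝ} (hA : 0 < A) (hX : 0 ≤ X) (he : 0 ≤ e) (hη : 0 ≤ η) (hη2 : η ≤ 1 / 2) (heη : e * η ≤ 1 / 4)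
    (ht0 : 0 ≤ t) (hG₀ : 0 < G₀) (hx : |G / G₀ - 1| ≤ x) (hx2 : x ≤ 1 / 2)
    (hhi : N ≤ A * ((X / (1 - η)) ^ e / Real.sqrt G + t * ((X / (1 / 4)) ^ e / Real.sqrt G))) :
    N ≤ A * X ^ e / Real.sqrt G₀ * ((1 + 4 * e * η + (4 : ℝ) ^ e * t) * (1 + x)) := by
  have hx0 : 0 ≤ x := (abs_nonneg _).trans hx
  have hXe0 : 0 ≤ X ^ e := Real.rpow_nonneg hX e
  have hsq_hi := inv_sqrt_le_of_ratio hG₀ hx hx2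
  have h1 : (X / (1 - η)) ^ e ≤ X ^ e * (1 + 4 * e * η) := rpow_div_one_sub_le hX hη hη2 he heη
  have h2 : (X / (1 / 4)) ^ e = (4 : ℝ) ^ e * X ^ e := rpow_div_inv_eq hX (by norm_num)
  have hbr : (X / (1 - η)) ^ e + t * (X / (1 / 4)) ^ e ≤ X ^ e * (1 + 4 * e * η + (4 : ℝ) ^ e * t) := by rw [h2]; nlinarith
  have hbr0 : 0 ≤ (X / (1 - η)) ^ e + t * (X / (1 / 4)) ^ e := by
    have : 0 ≤ (X / (1 - η)) ^ e := Real.rpow_nonneg (div_nonneg hX (by linarith)) e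
    have : 0 ≤ (X / (1 / 4)) ^ e := Real.rpow_nonneg (div_nonneg hX (by norm_num)) e
    positivity
  have hhi' : N ≤ A * (((X / (1 - η)) ^ e + t * (X / (1 / 4)) ^ e) * (1 / Real.sqrt G)) := by
    have : A * ((X / (1 - η)) ^ e / Real.sqrt G + t * ((X / (1 / 4)) ^ e / Real.sqrt G)) =
        A * (((X / (1 - η)) ^ e + t * (X / (1 / 4)) ^ e) * (1 / Real.sqrt G)) := by ring
    rw [← this]; exact hhi
  refine hhi'.trans ?_
  calc A * (((X / (1 - η)) ^ e + t * (X / (1 / 4)) ^ e) * (1 / Real.sqrt G))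
      ≤ A * ((X ^ e * (1 + 4 * e * η + (4 : ℝ) ^ e * t)) * ((1 + x) / Real.sqrt G₀)) := by
        refine mul_le_mul_of_nonneg_left ?_ hA.le
        exact mul_le_mul hbr hsq_hi (div_nonneg zero_le_one (Real.sqrt_nonneg _)) (mul_nonneg hXe0 (by positivity))
    _ = A * X ^ e / Real.sqrt G₀ * ((1 + 4 * e * η + (4 : ℝ) ^ e * t) * (1 + x)) := by ring

variable (L : ℕ) [NeZero L]

/-! ## §2 The constant `N̄(s)` -/

/-- ★ The would-be constant value of the Faddeev–Popov weight on the core at gauge width `s`: `N̄(s) = (2π²)^{-n}(πs²)^{d/2}/√(gramDet 0)`,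
`n = |NzSite L|`, `d = flatDim L = dim EuclideanSpace ℝ (NzSite L × Fin 3)`. [cite: Luscher1983, §3] -/
def fpWeightBar (s : ℝ) : ℝ :=
  ((2 * π ^ 2)⁻¹) ^ Fintype.card (NzSite L) * (π * s ^ 2) ^ (flatDim L / 2 : ℝ) / Real.sqrt (gramDet L 0)

/-- `0 < N̄(s)` for `s > 0`. [folklore] -/
theorem fpWeightBar_pos {s : ℝ} (hs : 0 < s) : 0 < fpWeightBar L s := by
  unfold fpWeightBar
  have h1 : 0 < Real.sqrt (gramDet L 0) := Real.sqrt_pos.mpr (gramDet_zero_pos L)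
  have h2 : 0 < (π * s ^ 2) ^ (flatDim L / 2 : ℝ) := Real.rpow_pos_of_pos (by positivity) _
  positivity

/-- The relative error size entering the Gaussian exponent: `η(M, p, r) = 3(M + 2‖basedLin p‖)·r·4C_L`. [folklore] -/
def fpEta (M : ℝ) (p : balancedSubmodule L × (Fin 3 → Fin 3 → ℝ)) (r : ℝ) : ℝ := 3 * ((M + 2 * ‖basedLin L p‖) * r * (4 * sliceConst L))

/-- `0 ≤ η` for `M, r ≥ 0`. [folklore] -/
theorem fpEta_nonneg {M : ℝ} (hM : 0 ≤ M) (p : balancedSubmodule L × (Fin 3 → Fin 3 → ℝ)) {r : ℝ} (hr : 0 ≤ r) : 0 ≤ fpEta L M p r := by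
  unfold fpEta; have := sliceConst_pos L; positivity

/-! ## §3 ★★★ The relative sandwich at a slice point -/

/-- ★★★ **THE FADDEEV–POPOV WEIGHT AT A SLICE POINT, RELATIVE TO `N̄(s)`.**  Under the hypotheses of `fpWeight_explicit_bounds` and the smallness conditions
`η ≤ 1/2`, `(d/2)η ≤ 1/4`, `2^{d/2}e^{−c²r²/(2s²)} ≤ 1/4`, `6nR₁² ≤ 1`, `|gramDet p/gramDet 0 − 1| ≤ x ≤ 1/2` (`η = fpEta L M p r`, `c = 1/(4C_L)`, `s = δg β`):
`N̄(s)(1 − 6nR₁²)(1 − (d/2)η − 2^{d/2}e^{−c²r²/(2s²)})(1 − x) ≤ N(tubePt p) ≤ N̄(s)(1 + 4(d/2)η + 4^{d/2}e^{−c²r²/(4s²)})(1 + x)`. [cite: Luscher1983, §3] -/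
theorem fpWeight_relative_bounds (hL : Nonempty (NzSite L)) {δ ρ δg : ℝ → ℝ} {β : ℝ} (hs : 0 < δg β)
    (p : balancedSubmodule L × (Fin 3 → Fin 3 → ℝ))
    (hpI : ∀ {a s : ℝ}, 0 < a → 0 < s →
      ∫ w, Real.exp (-(a * ‖laplaceMap L p w‖ ^ 2 / s ^ 2)) ∂(volume : Measure (NzSite L → Fin 3 → ℝ)) =
        (π * s ^ 2 / a) ^ (finrank ℝ (EuclideanSpace ℝ (NzSite L × Fin 3)) / 2 : ℝ) / Real.sqrt (gramDet L p))
    {εT M : ℝ} (hM0 : 0 ≤ M) (hεT : 0 < εT)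
    (hT : ∀ (ξ : basedSubmodule L) (q : balancedSubmodule L × (Fin 3 → Fin 3 → ℝ)), ‖ξ‖ < εT → ‖q‖ < εT →
      ‖basedFn L (ξ, q) - basedFn L (0, q) - basedLin L q ξ‖ ≤ M * ‖ξ‖ ^ 2)
    {εC : ℝ} (hC : ∀ q : balancedSubmodule L × (Fin 3 → Fin 3 → ℝ), ‖q‖ < εC →
      ∀ ξ : basedSubmodule L, ‖ξ‖ ≤ 4 * sliceConst L * ‖(gaugeModes L).starProjection (basedLin L q ξ)‖)
    (hpT : ‖p‖ < εT) (hpC : ‖p‖ < εC) (hp40 : ‖p‖ ≤ 1 / 40)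
    (hslice : (gaugeModes L).starProjection (linkEmbed L (p.1 : Edge 3 L → Fin 3 → ℝ)) = 0)
    {ρ₁ : ℝ} (hU : tubePt L p ∈ fatTubeRho L δ (fun _ => ρ₁) β)
    {r R₁ : ℝ} (hr0 : 0 ≤ r) (hrR : r ≤ R₁) (hR1 : R₁ ≤ 1 / 2) (hR1T : R₁ < εT) (hcore : ρ₁ + 8 * r ≤ ρ β)
    (hsupp : 3 * ((L : ℝ) - 1) * (ρ₁ + ρ β) ≤ R₁)
    (hθ : (M + 2 * ‖basedLin L p‖) * R₁ * (4 * sliceConst L) ≤ 1 / 4)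
    (hη2 : fpEta L M p r ≤ 1 / 2) (hηd : (flatDim L / 2 : ℝ) * fpEta L M p r ≤ 1 / 4)
    (htail : (2 : ℝ) ^ (flatDim L / 2 : ℝ) * Real.exp (-((1 / (4 * sliceConst L)) ^ 2 * r ^ 2 / (2 * δg β ^ 2))) ≤ 1 / 4)
    (hRn : 6 * (Fintype.card (NzSite L) : ℝ) * R₁ ^ 2 ≤ 1)
    {x : ℝ} (hx : |gramDet L p / gramDet L 0 - 1| ≤ x) (hx2 : x ≤ 1 / 2) :
    fpWeightBar L (δg β) * ((1 - 6 * (Fintype.card (NzSite L) : ℝ) * R₁ ^ 2) *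
        ((1 - (flatDim L / 2 : ℝ) * fpEta L M p r - (2 : ℝ) ^ (flatDim L / 2 : ℝ) * Real.exp (-((1 / (4 * sliceConst L)) ^ 2 * r ^ 2 / (2 * δg β ^ 2)))) *
          (1 - x))) ≤ gaugeAvg (recordWeightRho L δ ρ δg β) (tubePt L p) ∧
      gaugeAvg (recordWeightRho L δ ρ δg β) (tubePt L p) ≤ fpWeightBar L (δg β) *
        ((1 + 4 * (flatDim L / 2 : ℝ) * fpEta L M p r + (4 : ℝ) ^ (flatDim L / 2 : ℝ) * Real.exp (-((1 / (4 * sliceConst L)) ^ 2 * r ^ 2 / (4 * δg β ^ 2)))) *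
          (1 + x)) := by
  obtain ⟨hlo, hhi⟩ := fpWeight_explicit_bounds L hL hs p hpI hM0 hεT hT hC hpT hpC hp40 hslice hU hr0 hrR hR1 hR1T hcore hsupp hθ
  have hCpos := sliceConst_pos L
  have hη0 : 0 ≤ fpEta L M p r := fpEta_nonneg L hM0 p hr0
  have he0 : (0 : ℝ) ≤ (flatDim L / 2 : ℝ) := by positivity
  have hX0 : 0 ≤ π * δg β ^ 2 := by positivity
  have hA0 : 0 < ((2 * π ^ 2)⁻¹ : ℝ) ^ Fintype.card (NzSite L) := by positivity
  have hG0 := gramDet_zero_pos L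
  refine ⟨?_, ?_⟩
  · exact fpWeight_lower_algebra hA0 hX0 he0 hη0 hηd htail hRn hG0 hx hx2 hlo
  · exact fpWeight_upper_algebra hA0 hX0 he0 hη0 hη2 hηd (Real.exp_pos _).le hG0 hx hx2 hhi

end Summit.QuantumFields.YangMills.Theorems.FemtoTransferGap.TwoLattice.ConstTube

end
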